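import Summits.BirchSwinnertonDyer.BirchSwinnertonDyer.Theorems.RamifiedHeegnerPairLeafPartnerOrdersCoordinateRun
import Summits.BirchSwinnertonDyer.BirchSwinnertonDyer.Theorems.RamifiedHeegnerPairLeafPartnerBrandtFixedPoint
import Summits.BirchSwinnertonDyer.BirchSwinnertonDyer.Theorems.RamifiedHeegnerPairLeafPartnerBrandtDiagonalDual
import Literature.NumberTheory.Automorphic.BrandtHeckeProjector
import Literature.NumberTheory.EllipticCurves.TakahashiDegreeFormulaProofs
import Summits.BirchSwinnertonDyer.BirchSwinnertonDyer.Theorems.RamifiedHeegnerPairLeafPartnerOrdersDictionaryArithmetic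
import HarnessLib

/-!
# Route `RamifiedHeegnerPair`, crux U₁ `LeafRankOneUpperAtThree` (stmt-BirchSwinnertonDyer-26022), line `partnerdescent` —
# partner kernel, base change (α) part 8: THE RUN IN A BRANDT SETUP — everything the tree knows is discharged

HONEST FRAMING. Theorems only; helper file (`--supports stmt-BirchSwinnertonDyer-26022 --as helper`); composes ‹…CoordinateRun›
(`not_dvd_of_coordinateInputs`) with the tree's Brandt layer: `exact_eisenstein` (p806900), ‹DiagonalDual› (p812300),
`Brandt.exists_heckeProjector` (‹BrandtHeckeProjector›), `Takahashi2001.exists_index_formula` / `exists_eq_span_of_finrank_eq_one`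
(‹TakahashiDegreeFormulaProofs›), weight symmetry and column sums of the Brandt matrices; no new number theory, no named fact, no `sorry`;
nothing booked; BSD is proved for no curve. Lead prover bsd-line-rhp-p2 g64, 2026-08-31.

WHAT. `not_dvd_of_brandtCoordinateInputs`: for a Brandt setup `S` of type `(N⁺, N⁻)`, an eigenvalue system `λ` whose eigen-lattice is a LINE
(`hrank`, the dictionary's multiplicity one), a good prime `ℓ ∤ N⁺N⁻` with `3 ∤ λ(ℓ) − ℓ − 1` (Mazur + Chebotarev, tree:
`exists_prime_not_dvd_lFunction_sub_of_hasIrreducibleModPGaloisRep`), and the REMAINING TYPED INPUTS in Brandt coordinates — (C0) a set `G` of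
pairwise commuting integer matrices on `ℤ^{Cls O}` containing the Brandt matrices at the good primes, preserving degree zero, with an integral
twist `W` (`W W′ = W′ W = 1`, `W, W′` degree-preserving, `W T(ℓ) = T(ℓ) W`, `Xᵀ·D_w W = D_w W·X` for `X ∈ G`; `W = 1` when `G` consists of
`w`-symmetric matrices); (D) the character-group dictionary (`Y ≤ B` saturated and `G`-stable, `π^*, π_*` adjoint for Gross's pairing and
`c`, `π_* π^* = δ`, `π_*` onto, `π^* 1` in the eigen-line — the shape of `hDictDisc` of ‹…BrandtDictionaryProofs› plus `Y ≤ B` and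
`G`-stability); (C2′) the new-projector `u_Y ∈ ℤ[G]`; (C3′) multiplicity one in cosocle form at `(3, X − λ_X)`; (C5′) «`δ·(C y) = a·π_*(y)·π^*1`
on `Y`, `C ∈ ℤ[G]` ⟹ `δ ∣ a`» — EVERY solution `(i, j)`, `i > 0`, of Takahashi's system `i·j = c`, `δ·i = ξ_S(λ)·j` has **`3 ∤ j`**.
Discharged HERE from the tree: the generator `g` of the eigen-line and `ξ = ⟨g, g⟩`, `π^*1 = ±j·g` and `i = ` the generator of the pairing
ideal (Takahashi's Lemma 2.2 / Thm. 2.3, `exists_index_formula`, uniqueness of the solution), the `f`-projector `t = D·e_g ∈ ℤ[T_p : p good]`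
(`Brandt.exists_heckeProjector`) with `t B ⊆ ℤ g` (saturation of the eigen-lattice) and the dictionary identities `δ·(t y) = D·π_*(y)·π^*1`,
`(ξ/i)·(t y) = D·(±π_*(y))·g` (‹DictionaryArithmetic› p812314), the exact-Eisenstein vectors for the twisted pairing at `u = T(ℓ) − (ℓ + 1)`
(`exact_eisenstein` + `exists_degreeZero_dualVector`), positivity of the weights, and `δ = (ξ/i)·j`.
[cite: Takahashi2001, Lemma 2.2, Thm. 2.3] [cite: PapikianRabinoff2016, §3 ¶23–¶25, Lemma 24, Lemma 32] [cite: Gross1987, §1–§2]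
[cite: Ribet1990, Thm. 3.12] [cite: Mazur1977, II §15]
-/

set_option linter.dupNamespace false
set_option autoImplicit false

noncomputable section

open scoped Pointwise

namespace Summit.BirchSwinnertonDyer.BirchSwinnertonDyer.Theorems.LeafPartnerOrders

open Matrix IsLocalRing
open Literature.NumberTheory.Automorphic Literature.NumberTheory.Automorphic.Brandt
open Literature.NumberTheory.EllipticCurves.Takahashi2001 (exists_index_formula exists_eq_span_of_finrank_eq_one)
open Summit.BirchSwinnertonDyer.BirchSwinnertonDyer.Theorems.LeafPartnerBrandt (exact_eisenstein exists_degreeZero_dualVector)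

/-- `σ₁(ℓ) = ℓ + 1` for a prime `ℓ`. [folklore] -/
theorem sigma_one_prime {ℓ : ℕ} (hℓ : ℓ.Prime) : ArithmeticFunction.sigma 1 ℓ = ℓ + 1 := by
  have h := ArithmeticFunction.sigma_one_apply_prime_pow hℓ (i := 1)
  rw [pow_one] at h
  rw [h, Finset.sum_range_succ, Finset.sum_range_succ, Finset.sum_range_zero, pow_zero, pow_one, zero_add, add_comm]

/-- **The run in a Brandt setup** (see the module docstring). [cite: Takahashi2001, Lemma 2.2, Thm. 2.3]
[cite: PapikianRabinoff2016, §3 ¶23–¶25, Lemma 24, Lemma 32] -/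
theorem not_dvd_of_brandtCoordinateInputs {Nplus Nminus : ℕ} (S : XiSetup Nplus Nminus) [Fintype (ClassSet S.O)]
    [DecidableEq (ClassSet S.O)]
    (lamf : ℕ → ℤ) {ℓ : ℕ} (hℓ : ℓ.Prime) (hℓN : ¬ ℓ ∣ Nplus * Nminus) (h3ℓ : ¬ (3 : ℤ) ∣ lamf ℓ - (ℓ + 1))
    (hrank : Module.finrank ℤ (eigenLattice (Nplus * Nminus) (Brandt.matrix S.O) lamf) = 1)
    -- the degree-zero lattice
    (B : Submodule ℤ (ClassSet S.O → ℤ)) (hB : ∀ v, v ∈ B ↔ ∑ c, v c = 0)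
    -- (C0) generators and twist
    (G : Set (Matrix (ClassSet S.O) (ClassSet S.O) ℤ)) (hGcomm : ∀ X ∈ G, ∀ X' ∈ G, X * X' = X' * X)
    (hGdeg : ∀ X ∈ G, ∀ v : ClassSet S.O → ℤ, ∑ c, v c = 0 → ∑ c, (X *ᵥ v) c = 0)
    (hGan : ∀ q : ℕ, q.Prime → ¬ q ∣ Nplus * Nminus → Brandt.matrix S.O q ∈ G)
    (W W' : Matrix (ClassSet S.O) (ClassSet S.O) ℤ) (hWW' : W * W' = 1) (hW'W : W' * W = 1)
    (hWdeg : ∀ v : ClassSet S.O → ℤ, ∑ c, v c = 0 → ∑ c, (W *ᵥ v) c = 0)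
    (hW'deg : ∀ v : ClassSet S.O → ℤ, ∑ c, v c = 0 → ∑ c, (W' *ᵥ v) c = 0)
    (hWT : W * Brandt.matrix S.O ℓ = Brandt.matrix S.O ℓ * W)
    (hadj : ∀ X ∈ G, Xᵀ * (Matrix.diagonal (fun c ↦ (weight S.O c : ℤ)) * W) =
      (Matrix.diagonal (fun c ↦ (weight S.O c : ℤ)) * W) * X)
    (lam : Matrix (ClassSet S.O) (ClassSet S.O) ℤ → ℤ)
    (hglam : ∀ X ∈ G, ∀ v ∈ eigenLattice (Nplus * Nminus) (Brandt.matrix S.O) lamf, X *ᵥ v = lam X • v)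
    -- (D) the dictionary
    (Y : Submodule ℤ (ClassSet S.O → ℤ)) (pb : ℤ →ₗ[ℤ] Y) (pf : Y →ₗ[ℤ] ℤ) (c δ : ℕ) (hδ0 : 0 < δ)
    (hadjY : ∀ (a : ℤ) (y : Y), ∑ k, (weight S.O k : ℤ) * (pb a : ClassSet S.O → ℤ) k * (y : ClassSet S.O → ℤ) k = (c : ℤ) * a * pf y)
    (hδ : ∀ a : ℤ, pf (pb a) = (δ : ℤ) * a) (hsurj : Function.Surjective pf)
    (hYsat : ∀ (k : ℤ) (v : ClassSet S.O → ℤ), k ≠ 0 → k • v ∈ Y → v ∈ Y)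
    (hmem : (pb 1 : ClassSet S.O → ℤ) ∈ eigenLattice (Nplus * Nminus) (Brandt.matrix S.O) lamf)
    (hYB : Y ≤ B) (hYG : ∀ X ∈ G, ∀ y ∈ Y, X *ᵥ y ∈ Y)
    -- (C2′) the new-projector
    (uY : Matrix (ClassSet S.O) (ClassSet S.O) ℤ) (huYG : uY ∈ Algebra.adjoin ℤ G) (N₀ : ℤ) (hN₀ : N₀ ≠ 0)
    (huY : ∀ y ∈ Y, uY *ᵥ y = N₀ • y) (huYB : ∀ b ∈ B, uY *ᵥ b ∈ Y)
    -- (C3′) multiplicity one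
    (x₀ : ClassSet S.O → ℤ) (hx₀ : x₀ ∈ B)
    (hmult : ∀ x ∈ B, ∃ C ∈ Algebra.adjoin ℤ G, x - C *ᵥ x₀ ∈
      (3 : ℤ) • B ⊔ ⨆ X ∈ G, B.map (Matrix.mulVecLin (X - lam X • (1 : Matrix (ClassSet S.O) (ClassSet S.O) ℤ))))
    -- (C5′) degree ∣ congruence
    (hC5 : ∀ C ∈ Algebra.adjoin ℤ G, ∀ a : ℤ,
      (∀ y (hy : y ∈ Y), (δ : ℤ) • (C *ᵥ y) = a • pf ⟨y, hy⟩ • (pb 1 : ClassSet S.O → ℤ)) → (δ : ℤ) ∣ a)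
    -- the solution of Takahashi's system
    (i j : ℕ) (hi : 0 < i) (hij : i * j = c) (hδi : δ * i = S.xi lamf * j) :
    ¬ 3 ∣ j := by
  classical
  -- weights
  have hw : ∀ k : ClassSet S.O, 0 < weight S.O k := fun k ↦ S.one_le_weight k
  have hwz : ∀ k : ClassSet S.O, (weight S.O k : ℤ) ≠ 0 := fun k ↦ by exact_mod_cast (hw k).ne'
  -- 1. the generator of the eigen-line, `ξ = ⟨g, g⟩`
  obtain ⟨g, hg0, hL⟩ := exists_eq_span_of_finrank_eq_one hrank
  have hgL : g ∈ eigenLattice (Nplus * Nminus) (Brandt.matrix S.O) lamf := by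
    rw [hL]; exact Submodule.mem_span_singleton_self g
  have hξ : (S.xi lamf : ℤ) = ∑ k, (weight S.O k : ℤ) * g k * g k := by
    rw [XiSetup.xi, xiOfOrder_eq, xi_eq_sum _ hg0 hL, Nat.cast_sum]
    refine Finset.sum_congr rfl fun k _ ↦ ?_
    push_cast
    rw [sq_abs]; ring
  -- `π^* 1 = j' g`, `j' ≠ 0`, `g ∈ Y`
  have hmem' := hmem
  rw [hL] at hmem'
  obtain ⟨j', hj'⟩ := Submodule.mem_span_singleton.mp hmem'
  have hj'0 : j' ≠ 0 := by
    rintro rfl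
    have h0 : pb 1 = 0 := Subtype.ext (by rw [← hj', zero_smul]; rfl)
    have h1 := hδ 1
    rw [h0, map_zero, mul_one] at h1
    exact hδ0.ne' (by exact_mod_cast h1.symm)
  have hgY : g ∈ Y := hYsat j' g hj'0 (by rw [hj']; exact (pb 1).2)
  -- 2. Takahashi's index formula on `Y` with Gross's pairing
  let uJ : Y →ₗ[ℤ] Y →ₗ[ℤ] ℤ :=
    LinearMap.mk₂ ℤ (fun x y ↦ ∑ k, (weight S.O k : ℤ) * (x : ClassSet S.O → ℤ) k * (y : ClassSet S.O → ℤ) k)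
      (fun x₁ x₂ y ↦ by simp only [Submodule.coe_add, Pi.add_apply, mul_add, add_mul, Finset.sum_add_distrib])
      (fun a x y ↦ by
        simp only [Submodule.coe_smul, Pi.smul_apply, smul_eq_mul, Finset.mul_sum]
        exact Finset.sum_congr rfl fun k _ ↦ by ring)
      (fun x y₁ y₂ ↦ by simp only [Submodule.coe_add, Pi.add_apply, mul_add, Finset.sum_add_distrib])
      (fun a x y ↦ by
        simp only [Submodule.coe_smul, Pi.smul_apply, smul_eq_mul, Finset.mul_sum]
        exact Finset.sum_congr rfl fun k _ ↦ by ring)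
  have huJ : ∀ x y : Y, uJ x y = ∑ k, (weight S.O k : ℤ) * (x : ClassSet S.O → ℤ) k * (y : ClassSet S.O → ℤ) k :=
    fun x y ↦ rfl
  let uE : ℤ →ₗ[ℤ] ℤ →ₗ[ℤ] ℤ :=
    LinearMap.mk₂ ℤ (fun a b ↦ (c : ℤ) * a * b) (fun a₁ a₂ b ↦ by ring) (fun m a b ↦ by simp only [smul_eq_mul]; ring)
      (fun a b₁ b₂ ↦ by ring) (fun m a b ↦ by simp only [smul_eq_mul]; ring)
  have huE : ∀ a b : ℤ, uE a b = (c : ℤ) * a * b := fun a b ↦ rfl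
  let gY : Y := ⟨g, hgY⟩
  have hpbg : pb 1 = j' • gY := Subtype.ext (by rw [Submodule.coe_smul]; exact hj'.symm)
  have hgg : uJ gY gY = (S.xi lamf : ℤ) := by rw [huJ, hξ]
  have hξpos : 0 < (S.xi lamf : ℤ) := by
    rw [hξ]
    obtain ⟨k₀, hk₀⟩ : ∃ k, g k ≠ 0 := Function.ne_iff.mp hg0
    refine Finset.sum_pos' (fun k _ ↦ ?_) ⟨k₀, Finset.mem_univ _, ?_⟩
    · rw [mul_assoc]; exact mul_nonneg (by exact_mod_cast (hw k).le) (mul_self_nonneg _)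
    · rw [mul_assoc]; exact mul_pos (by exact_mod_cast hw k₀) (mul_self_pos.mpr hk₀)
  have hc0 : 0 < uE 1 1 := by
    -- `j' ⟨g, g⟩ = ⟨π^*1, g⟩ = c π_* g`, `⟨g, g⟩ > 0`, `j' ≠ 0`
    rw [huE, mul_one, mul_one]
    by_contra hc
    have hc' : (c : ℤ) = 0 := by
      have : (0 : ℤ) ≤ c := by exact_mod_cast Nat.zero_le c
      omega
    have h := hadjY 1 gY
    rw [hpbg, Submodule.coe_smul, hc', zero_mul, zero_mul] at h
    have h' : j' * ∑ k, (weight S.O k : ℤ) * g k * g k = 0 := by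
      rw [Finset.mul_sum, ← h]
      exact Finset.sum_congr rfl fun k _ ↦ by simp only [Pi.smul_apply, smul_eq_mul]; ring
    rw [← hξ] at h'
    rcases mul_eq_zero.mp h' with h1 | h1
    · exact hj'0 h1
    · exact hξpos.ne' h1
  obtain ⟨i₀, hi₀, hI, hi₀j, hih, hδi₀⟩ := exists_index_formula uJ uE pb pf
    (fun a y ↦ by rw [huJ, huE, ← hadjY a y]) (fun a ↦ by rw [hδ a, smul_eq_mul])
    hsurj (fun x ↦ ⟨x, by rw [smul_eq_mul, mul_one]⟩) hc0 hpbg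
  rw [huE, mul_one, mul_one] at hi₀j
  rw [hgg] at hih hδi₀
  -- 3. uniqueness of the solution: `(i, j) = (i₀, |j'|)`
  have hii : i = i₀ := by
    have h1 : ((δ * i * i : ℕ) : ℤ) = ((δ * i₀ * i₀ : ℕ) : ℤ) := by
      push_cast
      have e1 : (δ : ℤ) * i * i = (S.xi lamf : ℤ) * (i * j : ℕ) := by
        rw [show ((δ : ℤ) * i) = ((δ * i : ℕ) : ℤ) by push_cast; ring, hδi]; push_cast; ring
      have e2 : (δ : ℤ) * i₀ * i₀ = (S.xi lamf : ℤ) * (i₀ * |j'|) := by rw [hδi₀]; ring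
      rw [e1, e2, hij, hi₀j]
    have h2 : δ * i * i = δ * i₀ * i₀ := by exact_mod_cast h1
    rw [mul_assoc, mul_assoc] at h2
    exact Nat.mul_self_inj.mp (Nat.eq_of_mul_eq_mul_left hδ0 h2)
  subst hii
  have hjj : (j : ℤ) = |j'| := by
    have h1 : (i : ℤ) * j = (i : ℤ) * |j'| := by rw [hi₀j]; exact_mod_cast hij
    exact mul_left_cancel₀ (by exact_mod_cast hi.ne') h1
  -- `ε = sign j'`
  obtain ⟨ε, hε, hεj⟩ : ∃ ε : ℤ, ε * ε = 1 ∧ j' = ε * j := by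
    rcases le_or_gt 0 j' with h | h
    · exact ⟨1, one_mul 1, by rw [one_mul, hjj, abs_of_nonneg h]⟩
    · exact ⟨-1, by norm_num, by rw [hjj, abs_of_neg h]; ring⟩
  -- `Rl = ξ / i`, `δ = Rl j`
  obtain ⟨Rl, hRl⟩ : ∃ Rl : ℕ, S.xi lamf = i * Rl := by
    obtain ⟨r, hr⟩ := hih
    have hr0 : 0 ≤ r := by
      by_contra hneg
      have : (S.xi lamf : ℤ) < 0 := by
        rw [hr]; exact mul_neg_of_pos_of_neg (by exact_mod_cast hi) (by omega)
      omega
    refine ⟨r.toNat, ?_⟩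
    have : ((i * r.toNat : ℕ) : ℤ) = (S.xi lamf : ℤ) := by push_cast; rw [Int.toNat_of_nonneg hr0, hr]
    exact_mod_cast this.symm
  have hδRl : δ = Rl * j := by
    have h1 : δ * i = Rl * j * i := by rw [hδi, hRl]; ring
    exact Nat.eq_of_mul_eq_mul_right hi h1
  have hj0 : j ≠ 0 := by rintro rfl; rw [mul_zero] at hδRl; omega
  have hjz : (j : ℤ) ≠ 0 := by exact_mod_cast hj0
  have hξ0 : (S.xi lamf : ℤ) ≠ 0 := hξpos.ne'
  have hiz : (i : ℤ) ≠ 0 := by exact_mod_cast hi.ne'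
  -- 4. eigenvalues: `λ_{T(ℓ)} = λ(ℓ)`
  have hlamℓ : lam (Brandt.matrix S.O ℓ) = lamf ℓ := by
    have h1 := hglam _ (hGan ℓ hℓ hℓN) g hgL
    rw [hgL ℓ hℓ hℓN] at h1
    obtain ⟨k₀, hk₀⟩ : ∃ k, g k ≠ 0 := Function.ne_iff.mp hg0
    have := congrFun h1 k₀
    simp only [Pi.smul_apply, smul_eq_mul] at this
    exact (mul_right_cancel₀ hk₀ this).symm
  have hunit : ¬ (3 : ℤ) ∣ lam (Brandt.matrix S.O ℓ) - ((ArithmeticFunction.sigma 1 ℓ : ℕ) : ℤ) := by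
    rw [hlamℓ, sigma_one_prime hℓ]; push_cast; exact h3ℓ
  -- 5. exact Eisenstein for the twisted pairing at `u = T(ℓ) − (ℓ + 1)`
  have hW'T : W' * Brandt.matrix S.O ℓ = Brandt.matrix S.O ℓ * W' := by
    calc W' * Brandt.matrix S.O ℓ = W' * Brandt.matrix S.O ℓ * (W * W') := by rw [hWW', Matrix.mul_one]
      _ = W' * (Brandt.matrix S.O ℓ * W) * W' := by rw [Matrix.mul_assoc, Matrix.mul_assoc, Matrix.mul_assoc]
      _ = W' * (W * Brandt.matrix S.O ℓ) * W' := by rw [hWT]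
      _ = Brandt.matrix S.O ℓ * W' := by rw [← Matrix.mul_assoc, hW'W, Matrix.one_mul]
  have hsymmQ : ∀ (x : ClassSet S.O → ℚ) (y : ClassSet S.O → ℤ),
      ∑ c, (weight S.O c : ℚ) * (Matrix.toLin' ((Brandt.matrix S.O ℓ).map (Int.cast : ℤ → ℚ)) x) c * (y c : ℚ) =
        ∑ c, (weight S.O c : ℚ) * x c * (((Brandt.matrix S.O ℓ *ᵥ y) c : ℤ) : ℚ) := by
    intro x y
    simp only [Matrix.toLin'_apply, mulVec, dotProduct, Matrix.map_apply, Int.cast_sum, Int.cast_mul, Finset.mul_sum,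
      Finset.sum_mul]
    rw [Finset.sum_comm]
    refine Finset.sum_congr rfl fun d _ ↦ Finset.sum_congr rfl fun c _ ↦ ?_
    have hsym : ((weight S.O c : ℤ) : ℚ) * ((Brandt.matrix S.O ℓ c d : ℤ) : ℚ) =
        ((weight S.O d : ℤ) : ℚ) * ((Brandt.matrix S.O ℓ d c : ℤ) : ℚ) := by
      exact_mod_cast S.weight_mul_matrix_symm ℓ c d
    push_cast at hsym
    linear_combination x d * (y c : ℚ) * hsym
  have hEis : ∀ k : ClassSet S.O, ∃ z : ClassSet S.O → ℤ, ∑ c, z c = 0 ∧ ∀ b : ClassSet S.O → ℤ, ∑ c, b c = 0 →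
      z ⬝ᵥ ((Matrix.diagonal (fun c ↦ (weight S.O c : ℤ)) * W) *ᵥ b) =
        (Brandt.matrix S.O ℓ *ᵥ b) k - ((ArithmeticFunction.sigma 1 ℓ : ℕ) : ℤ) * b k := by
    intro k
    haveI : Nonempty (ClassSet S.O) := ⟨k⟩
    let ψ : (ClassSet S.O → ℤ) →ₗ[ℤ] ℤ := (LinearMap.proj k) ∘ₗ Matrix.mulVecLin W'
    have hψ : ∀ v, ψ v = (W' *ᵥ v) k := fun v ↦ rfl
    obtain ⟨x, hxdeg, hxdual⟩ := exists_degreeZero_dualVector (weight S.O) hw ψ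
    have hdeg' : S.degree x = 0 := by rw [XiSetup.degree_apply]; exact hxdeg
    obtain ⟨hint, hdeg0⟩ := exact_eisenstein S hℓ hℓN x hdeg' (fun b hb ↦ ⟨ψ b, hxdual b hb⟩)
    choose zf hzf using hint
    refine ⟨zf, ?_, fun b hb ↦ ?_⟩
    · have h := hdeg0
      rw [XiSetup.degree_apply] at h
      have : ((∑ c, zf c : ℤ) : ℚ) = 0 := by
        rw [Int.cast_sum, ← h]
        exact Finset.sum_congr rfl fun c _ ↦ (hzf c).symm
      exact_mod_cast this
    · have hWb : ∑ c, (W *ᵥ b) c = 0 := hWdeg b hb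
      have hTWb : ∑ c, (Brandt.matrix S.O ℓ *ᵥ (W *ᵥ b)) c = 0 := hGdeg _ (hGan ℓ hℓ hℓN) _ hWb
      have e1 : ψ (W *ᵥ b) = b k := by rw [hψ, mulVec_mulVec, hW'W, one_mulVec]
      have e2 : ψ (Brandt.matrix S.O ℓ *ᵥ (W *ᵥ b)) = (Brandt.matrix S.O ℓ *ᵥ b) k := by
        rw [hψ, mulVec_mulVec, mulVec_mulVec, hW'T, Matrix.mul_assoc, hW'W, Matrix.mul_one]
      -- the identity over `ℚ`
      have key : (((zf ⬝ᵥ ((Matrix.diagonal (fun c ↦ (weight S.O c : ℤ)) * W) *ᵥ b) : ℤ)) : ℚ) =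
          (((Brandt.matrix S.O ℓ *ᵥ b) k - ((ArithmeticFunction.sigma 1 ℓ : ℕ) : ℤ) * b k : ℤ) : ℚ) := by
        rw [← mulVec_mulVec]
        simp only [dotProduct, mulVec_diagonal, Int.cast_sum, Int.cast_mul, Int.cast_sub, Int.cast_natCast]
        have hz : ∀ c, (zf c : ℚ) = (Matrix.toLin' ((Brandt.matrix S.O ℓ).map (Int.cast : ℤ → ℚ)) x) c -
            ((ArithmeticFunction.sigma 1 ℓ : ℕ) : ℚ) * x c := fun c ↦ by
          simp only [← hzf c, Pi.sub_apply, Pi.smul_apply, smul_eq_mul]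
        simp_rw [hz]
        have hsplit : ∑ c, ((Matrix.toLin' ((Brandt.matrix S.O ℓ).map (Int.cast : ℤ → ℚ)) x) c -
              ((ArithmeticFunction.sigma 1 ℓ : ℕ) : ℚ) * x c) * ((weight S.O c : ℚ) * ((W *ᵥ b) c : ℚ)) =
            ∑ c, (weight S.O c : ℚ) * (Matrix.toLin' ((Brandt.matrix S.O ℓ).map (Int.cast : ℤ → ℚ)) x) c * ((W *ᵥ b) c : ℚ) -
              ((ArithmeticFunction.sigma 1 ℓ : ℕ) : ℚ) * ∑ c, (weight S.O c : ℚ) * x c * ((W *ᵥ b) c : ℚ) := by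
          rw [Finset.mul_sum, ← Finset.sum_sub_distrib]
          exact Finset.sum_congr rfl fun c _ ↦ by ring
        rw [hsplit, hsymmQ x (W *ᵥ b), hxdual _ hTWb, hxdual _ hWb, e1, e2]
      exact_mod_cast key
  -- 6. the `f`-projector `t = D·e_g` in the anemic Hecke ring
  obtain ⟨D, hD, Mt, hMt, hMtcd⟩ := Brandt.exists_heckeProjector (weight S.O) hw (Nplus * Nminus) (Brandt.matrix S.O)
    (fun p _ _ a b ↦ S.weight_mul_matrix_symm p a b) lamf hg0 hL
  have hxi_eq : (xi (weight S.O) (eigenLattice (Nplus * Nminus) (Brandt.matrix S.O) lamf) : ℤ) = (S.xi lamf : ℤ) := by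
    rw [XiSetup.xi, xiOfOrder_eq]
  have htG : Mt ∈ Algebra.adjoin ℤ G := by
    refine Algebra.adjoin_mono ?_ hMt
    rintro X ⟨p, hp, hpN, rfl⟩
    exact hGan p hp hpN
  have hMtx : ∀ x : ClassSet S.O → ℤ, (S.xi lamf : ℤ) • (Mt *ᵥ x) = ((D : ℤ) * ∑ d, (weight S.O d : ℤ) * g d * x d) • g := by
    intro x
    funext c'
    simp only [Pi.smul_apply, smul_eq_mul, mulVec, dotProduct, Finset.mul_sum, Finset.sum_mul]
    refine Finset.sum_congr rfl fun d _ ↦ ?_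
    have h := hMtcd c' d
    rw [hxi_eq] at h
    calc (S.xi lamf : ℤ) * (Mt c' d * x d) = ((S.xi lamf : ℤ) * Mt c' d) * x d := by ring
      _ = (D : ℤ) * (weight S.O d : ℤ) * g d * g c' * x d := by rw [h]
      _ = (D : ℤ) * ((weight S.O d : ℤ) * g d * x d) * g c' := by ring
  have htline : ∀ x ∈ B, ∃ n : ℤ, Mt *ᵥ x = n • g := by
    intro x _
    have hmemL : (S.xi lamf : ℤ) • (Mt *ᵥ x) ∈ eigenLattice (Nplus * Nminus) (Brandt.matrix S.O) lamf := by
      rw [hMtx, hL]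
      exact Submodule.smul_mem _ _ (Submodule.mem_span_singleton_self g)
    have h := mem_eigenLattice_of_smul_mem hξ0 hmemL
    rw [hL] at h
    obtain ⟨n, hn⟩ := Submodule.mem_span_singleton.mp h
    exact ⟨n, hn.symm⟩
  -- 7. the dictionary identities
  have hgy : ∀ y : Y, ∑ k, (weight S.O k : ℤ) * g k * (y : ClassSet S.O → ℤ) k = ε * i * pf y := by
    intro y
    have h := pairing_eq_of_adjunction uJ (g := gY) (pb1 := pb 1) (pf := fun y ↦ pf y) (c := (c : ℤ)) (i := (i : ℤ))
      (j := (j : ℤ)) (ε := ε) (fun y ↦ by rw [huJ, hadjY 1 y, mul_one]) (by rw [hpbg, hεj])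
      (by exact_mod_cast hij) hjz hε y
    rw [huJ] at h
    exact h
  have hpb1 : (pb 1 : ClassSet S.O → ℤ) = (ε * j) • g := by rw [← hj', hεj]
  have hP0 : ∀ (y : ClassSet S.O → ℤ) (hy : y ∈ Y),
      ((δ : ℕ) : ℤ) • (Mt *ᵥ y) = (D : ℤ) • pf ⟨y, hy⟩ • (pb 1 : ClassSet S.O → ℤ) := by
    intro y hy
    apply smul_right_injective (ClassSet S.O → ℤ) hξ0
    change (S.xi lamf : ℤ) • (((δ : ℕ) : ℤ) • (Mt *ᵥ y)) = (S.xi lamf : ℤ) • ((D : ℤ) • pf ⟨y, hy⟩ • (pb 1 : ClassSet S.O → ℤ))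
    rw [smul_comm, hMtx, hgy ⟨y, hy⟩, hpb1]
    funext c'
    simp only [Pi.smul_apply, smul_eq_mul]
    have hδi' : (δ : ℤ) * i = (S.xi lamf : ℤ) * j := by exact_mod_cast hδi
    linear_combination (D : ℤ) * ε * (pf ⟨y, hy⟩) * g c' * hδi'
  have hlat : ∀ y ∈ Y, ∃ y' ∈ Y, ((Rl : ℕ) : ℤ) • (Mt *ᵥ y) = (D : ℤ) • y' := by
    intro y hy
    refine ⟨(ε * pf ⟨y, hy⟩) • g, Y.smul_mem _ hgY, ?_⟩
    apply smul_right_injective (ClassSet S.O → ℤ) hiz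
    change (i : ℤ) • (((Rl : ℕ) : ℤ) • (Mt *ᵥ y)) = (i : ℤ) • ((D : ℤ) • (ε * pf ⟨y, hy⟩) • g)
    have hiRl : (i : ℤ) * Rl = S.xi lamf := by exact_mod_cast hRl.symm
    rw [smul_smul, hiRl, hMtx, hgy ⟨y, hy⟩]
    funext c'
    simp only [Pi.smul_apply, smul_eq_mul]
    ring
  -- 8. the integral extension `Ψ` of `π_*`
  obtain ⟨Ψ, hΨ⟩ := exists_extension_of_saturated Y hYsat pf
  have hP : ∀ y ∈ Y, ((δ : ℕ) : ℤ) • (Mt *ᵥ y) = (D : ℤ) • Ψ y • (pb 1 : ClassSet S.O → ℤ) := fun y hy ↦ by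
    rw [hΨ y hy]; exact hP0 y hy
  have hC5' : ∀ C ∈ Algebra.adjoin ℤ G, ∀ a : ℤ,
      (∀ y ∈ Y, ((δ : ℕ) : ℤ) • (C *ᵥ y) = a • Ψ y • (pb 1 : ClassSet S.O → ℤ)) → ((δ : ℕ) : ℤ) ∣ a :=
    fun C hC a h ↦ hC5 C hC a fun y hy ↦ by rw [← hΨ y hy]; exact h y hy
  -- 9. conclude with the coordinate run
  exact not_dvd_of_coordinateInputs (weight S.O) hw B hB G hGcomm hGdeg W W' hWW' hW'deg hadj g hg0 lam
    (fun X hX ↦ hglam X hX g hgL) (Brandt.matrix S.O ℓ) (hGan ℓ hℓ hℓN) ((ArithmeticFunction.sigma 1 ℓ : ℕ) : ℤ) hunit hEis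
    x₀ hx₀ hmult Y hYB hYsat hYG hgY uY huYG N₀ hN₀ huY huYB Mt htG htline Ψ (pb 1 : ClassSet S.O → ℤ) (hYB (pb 1).2)
    (D : ℤ) (by exact_mod_cast hD.ne') δ Rl j hδ0 hδRl hP hlat hC5'

end Summit.BirchSwinnertonDyer.BirchSwinnertonDyer.Theorems.LeafPartnerOrders

end
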